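import Summits.ValiantsHypothesis.ValiantsHypothesis.Theorems.NewtonUnitEquationsTwoProductsConfinedTameLawChart
import Literature.Algebra.EuclideanLattices.IntegerKernelSpan

/-!
# R10 (`positive-circuit-chart`) — part 3/3: REAL WEIGHTS and the CHART THEOREM
(iv): every real circuit of `Λ^⊥ ∩ ℝ^ι_{≥0}` is a positive real multiple of an atom (the solution line on a circuit support is
defined over `ℤ`: `Literature…IntegerKernelSpan.realKer_eq_span_intKer`), so every strictly positive `Λ`-orthogonal real weight
is `c⁻¹ · Σ_a θ_a · atom_a` with all `θ_a ≥ 1`; then ★ `positiveCircuitChart_holds` — the verbatim type of val-idea-37's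
`PositiveCircuitChart` (`Sketch.lean` l.33): `N = #circuit supports`, `M i a = atom_a(i)`, `D` = common denominator of the planar
coefficients, `G` their numerators.  R275 P3 scope: a TOOL for the proper positive sub-case rung R10 `ConfinedTameLaw` (val-idea-37 `positive-circuit-chart`);
nothing here closes 5906 (`TwoProducts` / `ResidualLawV21` / `PlanarCellBound` remain OPEN); VP ≠ VNP is NOT proved.
-/

set_option linter.dupNamespace false
set_option linter.unusedSectionVars false

/-! ## F2d — (iv): real circuits are multiples of atoms; product-free positive weights; the chart theorem -/

namespace Summit.ValiantsHypothesis.ValiantsHypothesis.Theorems.NewtonUnitEquations.TwoProducts.PermutationType.R10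

open scoped BigOperators
open Summit.ValiantsHypothesis.ValiantsHypothesis.Theorems.NewtonUnitEquations.TwoProducts.FormalLogLinearisation (Expo)

section RealSide
variable {ι : Type*} [Fintype ι] [DecidableEq ι] (Λ : Submodule ℤ (ι → ℤ))

/-- Membership in `Λ^⊥` is decided on a generating set. [folklore] -/
theorem mem_Vof_of_generators {F : Type*} [Field F] (sg : Finset (ι → ℤ)) (hsg : Submodule.span ℤ (sg : Set (ι → ℤ)) = Λ)
    (y : ι → F) (hy : ∀ g ∈ sg, ∑ j, (g j : F) * y j = 0) : y ∈ Vof F Λ := by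
  rw [mem_Vof]
  intro z hz
  rw [← hsg] at hz
  induction hz using Submodule.span_induction with
  | mem g hg => exact hy g hg
  | zero => simp
  | add a b _ _ ha hb => simp only [Pi.add_apply, Int.cast_add, add_mul, Finset.sum_add_distrib, ha, hb, add_zero]
  | smul n a _ ha =>
    simp only [Pi.smul_apply, smul_eq_mul, Int.cast_mul]
    have : ∑ j, (n : F) * (a j : F) * y j = (n : F) * ∑ j, (a j : F) * y j := by
      rw [Finset.mul_sum]; exact Finset.sum_congr rfl fun j _ => by ring
    rw [this, ha, mul_zero]

/-- **Every real circuit of `Λ^⊥ ∩ ℝ^ι_{≥0}` is a positive real multiple of an atom** (the solution space on a circuit support is a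
line defined over `ℤ`: `realKer_eq_span_intKer`). [folklore] -/
theorem exists_atom_of_real_circuit {c : ι → ℝ} (hc : IsCircuit (Vof ℝ Λ) c) :
    ∃ a : Fin (nAtoms Λ), ∃ t : ℝ, 0 < t ∧ c = t • castN ℝ (atom Λ a) := by
  classical
  -- generators of Λ
  have hfg : Λ.FG := IsNoetherian.noetherian Λ
  obtain ⟨sg, hsg⟩ := hfg
  set S := fsupp c with hSdef
  -- the integer matrix: generator rows and the unit rows off the support
  let Dm : Matrix (↥sg ⊕ ι) ι ℤ := fun r j => match r with
    | Sum.inl g => g.1 j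
    | Sum.inr i => if i ∈ S then 0 else (if j = i then 1 else 0)
  have hDm : ∀ {F : Type} [Field F] (y : ι → F), (Dm.map (Int.cast : ℤ → F)).mulVec y = 0 ↔
      (∀ g ∈ sg, ∑ j, (g j : F) * y j = 0) ∧ ∀ i, i ∉ S → y i = 0 := by
    intro F _ y
    constructor
    · intro h
      refine ⟨fun g hg => ?_, fun i hi => ?_⟩
      · have := congrFun h (Sum.inl ⟨g, hg⟩)
        simpa [Dm, Matrix.mulVec, dotProduct, Matrix.map_apply] using this
      · have := congrFun h (Sum.inr i)
        simpa [Dm, Matrix.mulVec, dotProduct, Matrix.map_apply, hi, Finset.sum_ite_eq', ite_apply] using this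
    · rintro ⟨h1, h2⟩
      funext r
      rcases r with ⟨g, hg⟩ | i
      · simpa [Dm, Matrix.mulVec, dotProduct, Matrix.map_apply] using h1 g hg
      · by_cases hi : i ∈ S
        · simp [Dm, Matrix.mulVec, dotProduct, Matrix.map_apply, hi]
        · simpa [Dm, Matrix.mulVec, dotProduct, Matrix.map_apply, hi] using h2 i hi
  -- c is in the real kernel
  have hcV : c ∈ Vof ℝ Λ := hc.1.1
  have hcker : (Dm.map (Int.cast : ℤ → ℝ)).mulVec c = 0 := by
    rw [hDm]
    refine ⟨fun g hg => (mem_Vof Λ c).1 hcV g (hsg ▸ Submodule.subset_span hg), fun i hi => ?_⟩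
    rw [hSdef, mem_fsupp] at hi; push Not at hi; exact hi
  have hcspan : c ∈ Submodule.span ℝ (Literature.Algebra.EuclideanLattices.IntegerKernelBasis.intKerReal Dm) := by
    rw [← Literature.Algebra.EuclideanLattices.IntegerKernelBasis.realKer_eq_span_intKer]
    simpa [LinearMap.mem_ker, Matrix.mulVecLin_apply] using hcker
  -- a nonzero integer kernel vector exists
  have hex : ∃ qz : ι → ℤ, Dm.mulVec qz = 0 ∧ qz ≠ 0 := by
    by_contra hnone
    push Not at hnone
    have hsub : Literature.Algebra.EuclideanLattices.IntegerKernelBasis.intKerReal Dm ⊆ {0} := by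
      rintro _ ⟨w, hw, rfl⟩
      rw [Set.mem_singleton_iff]
      funext j
      simp [hnone w hw]
    have : c = 0 := by
      have h := Submodule.span_mono (R := ℝ) hsub hcspan
      rw [Submodule.span_singleton_eq_bot.2 rfl] at h
      exact (Submodule.mem_bot ℝ).1 h
    exact hc.2.1 this
  obtain ⟨qz, hqz, hqz0⟩ := hex
  -- it lies on the line spanned by c
  have hqzV : (fun j => (qz j : ℝ)) ∈ Vof ℝ Λ := by
    have h := (hDm (fun j => (qz j : ℝ))).1 (by
      have : (Dm.map (Int.cast : ℤ → ℝ)).mulVec (fun j => (qz j : ℝ)) = fun r => ((Dm.mulVec qz) r : ℝ) := by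
        funext r; simp [Matrix.mulVec, dotProduct, Matrix.map_apply]
      rw [this, hqz]; funext r; simp)
    exact mem_Vof_of_generators Λ sg hsg _ h.1
  have hqzS : fsupp (fun j => (qz j : ℝ)) ⊆ fsupp c := by
    intro i hi
    by_contra hic
    have h := ((hDm (fun j => (qz j : ℝ))).1 (by
      have : (Dm.map (Int.cast : ℤ → ℝ)).mulVec (fun j => (qz j : ℝ)) = fun r => ((Dm.mulVec qz) r : ℝ) := by
        funext r; simp [Matrix.mulVec, dotProduct, Matrix.map_apply]
      rw [this, hqz]; funext r; simp)).2 i hic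
    rw [mem_fsupp] at hi; exact hi h
  obtain ⟨t, ht⟩ := eq_smul_of_fsupp_subset_circuit (Vof ℝ Λ) hc hqzV hqzS
  have ht0 : t ≠ 0 := by
    intro h0; rw [h0, zero_smul] at ht
    apply hqz0; funext j; have := congrFun ht j; simpa using this
  -- normalise the sign: a nonnegative integer vector qn with qn = |t| • c
  obtain ⟨qn, s, hs, hqn⟩ : ∃ qn : ι → ℕ, ∃ s : ℝ, 0 < s ∧ castN ℝ qn = s • c := by
    rcases lt_or_gt_of_ne ht0 with hneg | hpos
    · refine ⟨fun j => (-qz j).toNat, -t, neg_pos.mpr hneg, funext fun j => ?_⟩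
      have hj := congrFun ht j
      simp only [Pi.smul_apply, smul_eq_mul] at hj
      have hnn : 0 ≤ -qz j := by
        have : (qz j : ℝ) ≤ 0 := by rw [hj]; exact mul_nonpos_of_nonpos_of_nonneg hneg.le (hc.1.2 j)
        have : qz j ≤ 0 := by exact_mod_cast this
        omega
      simp only [castN, Pi.smul_apply, smul_eq_mul]
      have e1 : (((-qz j).toNat : ℕ) : ℝ) = ((-qz j : ℤ) : ℝ) := by
        have := Int.toNat_of_nonneg hnn; exact_mod_cast this
      rw [e1, Int.cast_neg, hj]; ring
    · refine ⟨fun j => (qz j).toNat, t, hpos, funext fun j => ?_⟩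
      have hj := congrFun ht j
      simp only [Pi.smul_apply, smul_eq_mul] at hj
      have hnn : 0 ≤ qz j := by
        have : (0 : ℝ) ≤ (qz j : ℝ) := by rw [hj]; exact mul_nonneg hpos.le (hc.1.2 j)
        exact_mod_cast this
      simp only [castN, Pi.smul_apply, smul_eq_mul]
      have e1 : (((qz j).toNat : ℕ) : ℝ) = ((qz j : ℤ) : ℝ) := by
        have := Int.toNat_of_nonneg hnn; exact_mod_cast this
      rw [e1, hj]
  -- qn is an integer circuit over ℚ with the support of c
  have hsuppR : fsupp (castN ℝ qn) = fsupp c := by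
    ext i; rw [mem_fsupp, mem_fsupp, hqn]; simp [hs.ne']
  have hsuppQ : fsupp (castN ℚ qn) = fsupp c := by
    rw [← hsuppR]; ext i; simp [mem_fsupp, castN]
  have hqnV : castN ℚ qn ∈ Vof ℚ Λ := by
    -- from the real membership of s • c = castN ℝ qn, via generators over ℤ
    have hR : castN ℝ qn ∈ Vof ℝ Λ := by rw [hqn]; exact (Vof ℝ Λ).smul_mem s hcV
    refine mem_Vof_of_generators Λ sg hsg _ fun g hg => ?_
    have h := (mem_Vof Λ _).1 hR g (hsg ▸ Submodule.subset_span hg)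
    have h' : ((∑ j, (g j : ℚ) * (qn j : ℚ) : ℚ) : ℝ) = 0 := by
      push_cast; simpa [castN] using h
    show ∑ j, (g j : ℚ) * (qn j : ℚ) = 0
    exact_mod_cast h'
  have hqnCirc : IsCircuit (Vof ℚ Λ) (castN ℚ qn) := by
    refine ⟨⟨hqnV, fun i => by simp [castN]⟩, ?_, fun y hy hy0 hsub => ?_⟩
    · intro h0
      have : fsupp (castN ℚ qn) = ∅ := (fsupp_eq_empty_iff _).2 h0
      rw [hsuppQ, fsupp_eq_empty_iff] at this
      exact hc.2.1 this
    · -- lift y to ℝ and use the minimality of c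
      set yR : ι → ℝ := fun i => (y i : ℝ) with hyR
      have hyRV : yR ∈ Vof ℝ Λ := by
        rw [mem_Vof]; intro z hz
        have := (mem_Vof Λ y).1 hy.1 z hz
        have h' : ((∑ i, (z i : ℚ) * y i : ℚ) : ℝ) = 0 := by rw [this]; simp
        simpa [hyR] using h'
      have hyRK : InCone (Vof ℝ Λ) yR := ⟨hyRV, fun i => by simp only [hyR]; exact_mod_cast hy.2 i⟩
      have hyR0 : yR ≠ 0 := by
        intro h; apply hy0; funext i; have := congrFun h i; simp only [hyR, Pi.zero_apply] at this; exact_mod_cast this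
      have hsuppy : fsupp yR = fsupp y := by ext i; simp [mem_fsupp, hyR]
      have h1 : fsupp yR ⊆ fsupp c := by rw [hsuppy, ← hsuppQ]; exact hsub
      have h2 := hc.2.2 yR hyRK hyR0 h1
      rw [hsuppQ, ← hsuppy, h2]
  -- hence an atom with this support, proportional over ℚ, hence over ℝ
  have hInt : IsIntCircuit Λ (fsupp c) qn := ⟨hqnCirc, hsuppQ⟩
  have hS : fsupp c ∈ circuitSupports Λ := (mem_circuitSupports Λ _).2 ⟨qn, hInt⟩
  set a : Fin (nAtoms Λ) := (circuitSupports Λ).equivFin ⟨fsupp c, hS⟩ with ha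
  have hidx : ((circuitSupports Λ).equivFin.symm a).1 = fsupp c := by rw [ha, Equiv.symm_apply_apply]
  have hat := atom_spec Λ a
  rw [hidx] at hat
  obtain ⟨u, hu, hqu⟩ := circuit_unique (Vof ℚ Λ) hqnCirc hat.1 (hsuppQ.trans hat.2.symm)
  have hquR : castN ℝ qn = (u : ℝ) • castN ℝ (atom Λ a) := by
    funext i
    have := congrFun hqu i
    simp only [castN, Pi.smul_apply, smul_eq_mul] at this ⊢
    exact_mod_cast this
  refine ⟨a, s⁻¹ * u, mul_pos (inv_pos.mpr hs) (by exact_mod_cast hu), ?_⟩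
  have : c = s⁻¹ • castN ℝ qn := by rw [hqn, smul_smul, inv_mul_cancel₀ hs.ne', one_smul]
  rw [this, hquR, smul_smul]

/-- Positive real combinations of real circuits are nonnegative real combinations of atoms. [folklore] -/
theorem exists_real_coeffs_of_list (l : List (ℝ × (ι → ℝ))) (hl : ∀ p ∈ l, 0 < p.1 ∧ IsCircuit (Vof ℝ Λ) p.2) :
    ∃ g : Fin (nAtoms Λ) → ℝ, (∀ a, 0 ≤ g a) ∧ (l.map fun p => p.1 • p.2).sum = ∑ a, g a • castN ℝ (atom Λ a) := by
  classical
  induction l with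
  | nil => exact ⟨fun _ => 0, fun _ => le_rfl, by simp⟩
  | cons p l ih =>
    obtain ⟨g, hg, hsum⟩ := ih (fun p' hp' => hl p' (List.mem_cons_of_mem _ hp'))
    obtain ⟨hp1, hp2⟩ := hl p (by simp)
    obtain ⟨a, t, ht, hpt⟩ := exists_atom_of_real_circuit Λ hp2
    refine ⟨g + Pi.single a (p.1 * t), fun b => ?_, ?_⟩
    · simp only [Pi.add_apply]
      by_cases hb : b = a
      · subst hb; simp only [Pi.single_eq_same]; exact add_nonneg (hg b) (mul_pos hp1 ht).le
      · rw [Pi.single_eq_of_ne hb, add_zero]; exact hg b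
    · rw [List.map_cons, List.sum_cons, hsum, hpt]
      simp only [Pi.add_apply, add_smul, Finset.sum_add_distrib]
      rw [add_comm]
      congr 1
      rw [Finset.sum_eq_single a (fun b _ hb => by rw [Pi.single_eq_of_ne hb, zero_smul]) (fun h => absurd (Finset.mem_univ a) h),
        Pi.single_eq_same, smul_smul]

/-- **(iv) of the chart**: every strictly positive `Λ`-orthogonal real weight is, up to a positive scalar, a combination of the atoms
with all coefficients `≥ 1`. [folklore] -/
theorem exists_weights (r : ι → ℝ) (hr : ∀ i, 0 < r i) (hrΛ : ∀ z ∈ Λ, ∑ i, (z i : ℝ) * r i = 0) :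
    ∃ θ : Fin (nAtoms Λ) → ℝ, (∀ a, 1 ≤ θ a) ∧ ∃ c : ℝ, 0 < c ∧ ∀ i, ∑ a, ((atom Λ a i : ℕ) : ℝ) * θ a = c * r i := by
  classical
  -- the sum of all atoms, a nonnegative integer vector in Λ^⊥
  set Ssum : ι → ℝ := fun i => ∑ a, ((atom Λ a i : ℕ) : ℝ) with hSsum
  rcases isEmpty_or_nonempty ι with hι | hι
  · refine ⟨fun _ => 1, fun _ => le_rfl, 1, one_pos, fun i => (IsEmpty.false i).elim⟩
  -- ε small enough that r - ε Ssum stays strictly positive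
  obtain ⟨i₁, -, hmin⟩ := Finset.exists_min_image Finset.univ r Finset.univ_nonempty
  obtain ⟨i₂, -, hmax⟩ := Finset.exists_max_image Finset.univ Ssum Finset.univ_nonempty
  have hSnn : ∀ i, 0 ≤ Ssum i := fun i => Finset.sum_nonneg fun a _ => by positivity
  set ε : ℝ := r i₁ / (2 * (Ssum i₂ + 1)) with hε
  have hεpos : 0 < ε := div_pos (hr i₁) (by have := hSnn i₂; positivity)
  set x : ι → ℝ := fun i => r i - ε * Ssum i with hx
  have hxpos : ∀ i, 0 < x i := by
    intro i
    have h1 : r i₁ ≤ r i := hmin i (Finset.mem_univ i)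
    have h2 : Ssum i ≤ Ssum i₂ := hmax i (Finset.mem_univ i)
    have h3 : ε * Ssum i ≤ ε * Ssum i₂ := mul_le_mul_of_nonneg_left h2 hεpos.le
    have hS1 : (0 : ℝ) < Ssum i₂ + 1 := by have := hSnn i₂; linarith
    have h4 : ε * (Ssum i₂ + 1) = r i₁ / 2 := by rw [hε]; field_simp
    have h5 : ε * Ssum i₂ < r i₁ / 2 := by nlinarith
    have h0 := hr i₁
    simp only [hx]; linarith
  have hxV : x ∈ Vof ℝ Λ := by
    rw [mem_Vof]; intro z hz
    simp only [hx, mul_sub, Finset.sum_sub_distrib, hrΛ z hz, zero_sub, neg_eq_zero]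
    have hatoms : ∀ a, ∑ i, (z i : ℝ) * ((atom Λ a i : ℕ) : ℝ) = 0 := fun a => by
      have h := (mem_Vof Λ _).1 (atom_mem_V Λ a) z hz
      have h' : ((∑ i, (z i : ℚ) * (atom Λ a i : ℚ) : ℚ) : ℝ) = 0 := by simpa [castN] using congrArg (fun q : ℚ => (q : ℝ)) h
      push_cast at h'; exact h'
    have : ∑ i, (z i : ℝ) * (ε * Ssum i) = ε * ∑ a, ∑ i, (z i : ℝ) * ((atom Λ a i : ℕ) : ℝ) := by
      rw [Finset.sum_comm, Finset.mul_sum]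
      refine Finset.sum_congr rfl fun i _ => ?_
      simp only [hSsum, Finset.mul_sum]
      exact Finset.sum_congr rfl fun a _ => by ring
    rw [this]; simp [hatoms]
  have hxK : InCone (Vof ℝ Λ) x := ⟨hxV, fun i => (hxpos i).le⟩
  obtain ⟨l, hl, hsum⟩ := conformal_decomposition (Vof ℝ Λ) _ x le_rfl hxK
  obtain ⟨g, hg, hgsum⟩ := exists_real_coeffs_of_list Λ l (fun p hp => ⟨(hl p hp).1, (hl p hp).2.1⟩)
  have hxg : ∀ i, x i = ∑ a, g a * ((atom Λ a i : ℕ) : ℝ) := fun i => by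
    have := congrFun (hsum.trans hgsum) i
    simpa [Finset.sum_apply, Pi.smul_apply, smul_eq_mul, castN] using this
  refine ⟨fun a => g a / ε + 1, fun a => by have := hg a; have := div_nonneg this hεpos.le; linarith, ε⁻¹, inv_pos.mpr hεpos,
    fun i => ?_⟩
  have hri : r i = x i + ε * Ssum i := by simp only [hx]; ring
  rw [hri, hxg i]
  simp only [hSsum, Finset.mul_sum, mul_add, Finset.sum_add_distrib]
  rw [← Finset.sum_add_distrib, ← Finset.sum_add_distrib]
  refine Finset.sum_congr rfl fun a _ => ?_
  field_simp

end RealSide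

end Summit.ValiantsHypothesis.ValiantsHypothesis.Theorems.NewtonUnitEquations.TwoProducts.PermutationType.R10


/-! ## F2e — ASSEMBLY: the chart theorem, verbatim type of `PositiveCircuitChart` (val-idea-37 `Sketch.lean` l.33) -/

namespace Summit.ValiantsHypothesis.ValiantsHypothesis.Theorems.NewtonUnitEquations.TwoProducts.PermutationType.R10

open scoped BigOperators
open Summit.ValiantsHypothesis.ValiantsHypothesis.Theorems.NewtonUnitEquations.TwoProducts.FormalLogLinearisation (Expo)

/-- **THE POSITIVE-CIRCUIT CHART** (rung R10 `positive-circuit-chart`, first lemma; verbatim type of val-idea-37's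
`PositiveCircuitChart`): for nonzero planar letters `e : ι → Expo` and any lattice `Λ` of additive relations among them there is a
nonnegative integer lift `M : ι → ℕ^N` (atoms = integer positive circuits of `Λ^⊥ ∩ ℚ^ι_{≥0}`) with (i) no letter sent to `0`,
(ii) a nonnegative planar push-forward `G` after a dilation `D`, (iii) integer kernel = the saturation of `Λ`, (iv) every strictly
positive `Λ`-orthogonal real weight is, up to a positive scalar, the pull-back of upstairs weights `≥ 1`.
R275 P3 scope: a proper positive sub-case tool; nothing here closes 5906; VP ≠ VNP is not proved. [folklore] -/
theorem positiveCircuitChart_holds :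
    ∀ (ι : Type) [Fintype ι] [DecidableEq ι] (e : ι → Expo), (∀ i, e i ≠ 0) →
    ∀ Λ : Submodule ℤ (ι → ℤ), (∀ z ∈ Λ, ∀ c : Fin 2, ∑ i, z i * ((e i) c : ℤ) = 0) →
    ∃ (N : ℕ) (M : ι → (Fin N →₀ ℕ)) (D : ℕ) (G : Fin N → Expo),
      (∀ i, M i ≠ 0) ∧ 0 < D ∧
      (∀ i, D • e i = ∑ a, (M i) a • G a) ∧
      (∀ z : ι → ℤ, (∀ a : Fin N, ∑ i, z i * ((M i) a : ℤ) = 0) ↔ ∃ k : ℕ, 0 < k ∧ (fun i => (k : ℤ) * z i) ∈ Λ) ∧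
      (∀ r : ι → ℝ, (∀ i, 0 < r i) → (∀ z ∈ Λ, ∑ i, (z i : ℝ) * r i = 0) →
        ∃ θ : Fin N → ℝ, (∀ a, 1 ≤ θ a) ∧ ∃ c : ℝ, 0 < c ∧ ∀ i, ∑ a, ((M i) a : ℝ) * θ a = c * r i) := by
  intro ι _ _ e he Λ hΛ
  classical
  -- planar coefficients for both coordinates
  have H := fun c : Fin 2 => exists_planar_coeffs Λ e hΛ c
  choose g hg0 hg using H
  -- common denominator
  set D : ℕ := ∏ c, ∏ a, (g c a).den with hD
  have hDpos : 0 < D := Finset.prod_pos fun c _ => Finset.prod_pos fun a _ => (g c a).den_pos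
  have hdvd : ∀ c a, (g c a).den ∣ D := by
    intro c a
    have h1 : (g c a).den ∣ ∏ a', (g c a').den := Finset.dvd_prod_of_mem (fun a' => (g c a').den) (Finset.mem_univ a)
    have h2 : (∏ a', (g c a').den) ∣ D := by
      rw [hD]; exact Finset.dvd_prod_of_mem (fun c' => ∏ a', (g c' a').den) (Finset.mem_univ c)
    exact h1.trans h2
  have Hn := fun c a => exists_nat_eq_mul_of_den_dvd (g c a) (hg0 c a) D (hdvd c a)
  choose n hn using Hn
  refine ⟨nAtoms Λ, fun i => Finsupp.equivFunOnFinite.symm (fun a => atom Λ a i), D,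
    fun a => Finsupp.equivFunOnFinite.symm (fun c => n c a), ?_, hDpos, ?_, ?_, ?_⟩
  · -- (i)
    intro i h0
    obtain ⟨a, ha⟩ := exists_atom_ne_zero Λ e he hΛ i
    apply ha
    have := DFunLike.congr_fun h0 a
    simpa using this
  · -- (ii)
    intro i
    ext c
    simp only [Finsupp.smul_apply, smul_eq_mul, Finsupp.coe_finsetSum, Finset.sum_apply,
      Finsupp.coe_equivFunOnFinite_symm]
    have h1 : ((D * (e i) c : ℕ) : ℚ) = ((∑ a, atom Λ a i * n c a : ℕ) : ℚ) := by
      push_cast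
      rw [hg c i, Finset.mul_sum]
      refine Finset.sum_congr rfl fun a _ => ?_
      rw [hn c a]; ring
    exact_mod_cast h1
  · -- (iii)
    intro z
    constructor
    · intro hz
      refine mem_sat_of_ortho_atoms Λ e he hΛ z fun a => ?_
      have := hz a
      simpa using this
    · rintro ⟨k, hk, hkz⟩ a
      have := ortho_atom_of_sat Λ z k hk hkz a
      simpa using this
  · -- (iv)
    intro r hr hrΛ
    obtain ⟨θ, hθ, c, hc, hsum⟩ := exists_weights Λ r hr hrΛ
    refine ⟨θ, hθ, c, hc, fun i => ?_⟩
    have := hsum i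
    simpa using this

end Summit.ValiantsHypothesis.ValiantsHypothesis.Theorems.NewtonUnitEquations.TwoProducts.PermutationType.R10

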